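import Literature.IUT.HodgeTheaters.TemperedCoveringsSlimnessKerForm
import Literature.IUT.HodgeTheaters.TemperedCoveringsCor23iiiOfSpecialFibre
import Literature.IUT.HodgeTheaters.StableCurveTemperedDataOfSpecialFibreTower
import HarnessLib

/-!
# [IUTchI] Corollary 2.3 (iii), first sentence, at ONE LEVEL `Ĵ_i ∩ Δ̂_X` of the GENUINE special-fibre
# tower: KER-LEVEL from EXACTLY the printed per-level inputs, every structural side condition discharged

Mochizuki, *Inter-universal Teichmüller theory I: construction of Hodge theaters*, kurims manuscript
(May 2020), §2, Corollary 2.3 (iii) p. 47, proof p. 48 l. 36 – p. 49 l. 32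
[cite: Mochizuki2012, Cor 2.3(iii) pp.47-49] (D-0012 claim key; series status DISPUTED; nothing of the
series is asserted here), over Mochizuki, *Semi-graphs of anabelioids*, Publ. RIMS **42** (2006),
Example 3.10 pp. 44–45 [cite: MochizukiSemiAnbd2006, Ex 3.10 pp.44-45].

PROOF-ONLY companion of `TemperedCoveringsCor23KerLevelOfTower` (node `IUTchI:Cor2.3(iii)`, board holder
abc-iut-w4-d058; GAP-LEDGER G-w4d058-1; no definition, no new named fact).  There the KER-LEVEL binders
of the Cor. 2.3 (i)–(iv) assembly at the genuine 𝔛-datum `StableCurveTemperedData.ofSpecialFibre` are read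
at the levels `Ĵ_i ∩ Δ̂_X` (`i : ℕ`) of abc-iut-L5-t11's `OfSpecialFibre.towerOfSpecialFibreTower`
(the closures in `Π̂_X` of the `N_i` of [SemiAnbd] Ex. 3.10).  Here ONE such level is reduced to the
printed per-level inputs:

* `kerLevel_towerLevel_of_inputs` — generic, over any `StableCurveTemperedData` and any `Prop24Tower`:
  abc-iut-w4-d058's `mem_level_of_comm_ker_of_inputs` (the kernel form of p. 48 l. 44 – p. 49 l. 32,
  condition (a)) at `J := Ĵ_i ∩ Δ̂_X`, the level's normality / openness being the tower laws
  `LevelsNormal` / `LevelsOpen`;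
* `kerLevel_ofSpecialFibre_towerLevel_of_inputs` — at the genuine datum: the level is normal and open
  (`towerOfSpecialFibreTower_levelsNormal` / `_levelsOpen`), `Δ̂_X` is closed, `ρ̂ : Δ̂_X ↠ Π̂_𝔾` is
  continuous, `Π̂_𝔾` is Hausdorff (`ofSpecialFibre_isClosed_deltaHat` / `_continuous_ρHat` /
  `_t2Space_graphHat`) and `Σ` is the datum's label set — ALL DISCHARGED; what remains is EXACTLY the
  printed per-level input list: the vertices `V` of the dual graph of the special fibre of `X_{J_i}` with
  their `Δ̂_X`-action `act`, `Ks = Ker(J ↠ J*)` (maximal pro-`Σ*` quotient, `Σ* = Σ ∪ {l}`), the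
  `J`-conjugacy classes `P_v` (`hequiv`), **(A3)** = [AbsTopII] Prop. 1.3 (iv) / [NodNon] Prop. 3.9 (i) in
  level form (`hA3`), the decomposition groups `J_v` (`hJvP`, `hJvJ`, `hJvc`), the prime `l ∉ Σ`, the
  maximal pro-`l` quotients `ql v : J_v ↠ L v` (nonabelian: "the pro-`l` completion of the fundamental
  group of a hyperbolic Riemann surface", p. 49 l. 3–5), "the image of the homomorphism
  `J_v ⊆ J ⊆ Δ̂_X ↠ Π̂_𝔾` is pro-`Σ`" (`hSigv`, p. 48 l. 62), the [SemiAnbd] Cor. 3.11 inertia step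
  (`TrivOn`, `h311`, p. 49 l. 20–23),
  `(J*)^{ab}` as a torsion-free `ℤ[Δ̂_X]`-module with the unipotence step (`ρab`, `hinner`, `hunip`,
  p. 49 l. 24–26) and [Config] Prop. 1.4 (`hfaith`, p. 49 l. 27–28).

These per-level inputs are the open content of G-w4d058-1 at the genuine tower (merge obligations over
the L3/L4 per-level objects / FACT-policy inputs); nothing here discharges them, and the branch (b)
argument via [Tama2] Thm. 0.2 (v) is not kernelised (the companion file shows it is not needed when
`Σ ∪ {p}` omits a prime).  Model-relative; typed ≠ discharged; nothing here bears on [IUTchIII] Cor. 3.12.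
(v2: doc-only — the `hSigv` quote restored verbatim, referee flag M19-F6; declarations unchanged.)
-/

noncomputable section

namespace Literature.IUT.HodgeTheaters

open _root_.Topology
open scoped Pointwise
open Literature.AnabelianGeometry.SemiGraphs

namespace StableCurveTemperedData

universe u

/-! ### Generic: one level of a `Prop24Tower` -/

section Generic

variable (D : StableCurveTemperedData.{u}) (T : D.Prop24Tower)

/-- **[IUTchI] Cor. 2.3 (iii), first sentence, at ONE tower level `Ĵ_i ∩ Δ̂_X`, condition (a),
KERNEL FORM**: every `α ∈ Δ̂_X` commuting with `(Ĵ_i ∩ Δ̂_X) ∩ Ker(Δ̂_X ↠ Π̂_𝔾)` lies in `Ĵ_i` — from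
EXACTLY the printed per-level inputs of `mem_level_of_comm_ker_of_inputs` at `J := Ĵ_i ∩ Δ̂_X` (see
that theorem: vertices `V` of the dual graph of the special fibre of `X_{J_i}` with the `Δ̂_X`-action
`act`, `Ks = Ker(J ↠ J*)`, the `P_v` (`hequiv`), (A3) (`hA3`), the decomposition groups `J_v`, the prime
`l ∉ Σ`, the maximal pro-`l` quotients `ql v`, the image of `J_v ⊆ J ⊆ Δ̂_X ↠ Π̂_𝔾` being pro-`Σ` (`hSigv`),
the [SemiAnbd] Cor. 3.11 step (`h311`), `(J*)^{ab}` (`ρab`, `hinner`, `hunip`), [Config] Prop. 1.4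
(`hfaith`)), the level's normality and openness being the tower laws `LevelsNormal` / `LevelsOpen`.
[cite: Mochizuki2012, Cor 2.3(iii) pp.48-49] -/
theorem kerLevel_towerLevel_of_inputs (hN : T.LevelsNormal) (hO : T.LevelsOpen)
    (hΔc : IsClosed (D.DeltaHat : Set D.PiHat)) [T2Space D.graph.Hat] (hρc : Continuous D.ρHat)
    (i : T.I)
    {V : Type*} (act : D.DeltaHat → V → V) (Ks : Subgroup D.DeltaHat)
    (Pv : V → Subgroup D.DeltaHat)
    (hequiv : ∀ (b : D.DeltaHat) (v : V), ∃ j ∈ (T.Jhat i).subgroupOf D.DeltaHat,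
      (Pv v).map (MulAut.conj b).toMonoidHom = (Pv (act b v)).map (MulAut.conj j).toMonoidHom)
    (hA3 : ∀ (v w : V), ∀ g ∈ (T.Jhat i).subgroupOf D.DeltaHat, ∀ h ∈ (T.Jhat i).subgroupOf D.DeltaHat,
      (∃ x ∈ (Pv v).map (MulAut.conj g).toMonoidHom ⊓ (Pv w).map (MulAut.conj h).toMonoidHom,
        ∃ y ∈ (Pv v).map (MulAut.conj g).toMonoidHom ⊓ (Pv w).map (MulAut.conj h).toMonoidHom,
          x * y * x⁻¹ * y⁻¹ ∉ Ks) → v = w)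
    (Jv : V → Subgroup D.DeltaHat) (hJvP : ∀ v, Jv v ≤ Pv v)
    (hJvJ : ∀ v, Jv v ≤ (T.Jhat i).subgroupOf D.DeltaHat)
    (hJvc : ∀ v, IsClosed (Jv v : Set D.DeltaHat))
    {l : ℕ} (hl : l ∉ D.graph.Sigma)
    (L : V → Type*) [∀ v, Group (L v)] [∀ v, TopologicalSpace (L v)]
    [∀ v, IsTopologicalGroup (L v)] [∀ v, CompactSpace (L v)]
    [∀ v, TotallyDisconnectedSpace (L v)] [∀ v, T2Space (L v)]
    (ql : ∀ v, Jv v →* L v) (hqlc : ∀ v, Continuous (ql v))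
    (hqls : ∀ v, Function.Surjective (ql v)) (hLl : ∀ v, IsProSigma {l} (L v))
    (hLna : ∀ v, ∃ x y : L v, x * y ≠ y * x)
    (hqlK : ∀ v (x : Jv v), (x : D.DeltaHat) ∈ Ks → ql v x = 1)
    (hSigv : ∀ (v : V) (M : Subgroup (Jv v)), M.Normal → IsOpen (M : Set (Jv v)) →
      (D.ρHat.ker).subgroupOf (Jv v) ≤ M → ∀ p : ℕ, p.Prime → p ∣ M.index → p ∈ D.graph.Sigma)
    (TrivOn : D.DeltaHat → V → Prop)
    (h311 : ∀ (b : D.DeltaHat) (v : V), act b v = v →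
      (∀ y : L v, ∃ x : Jv v, ql v x = y ∧ b * (x : D.DeltaHat) * b⁻¹ = x) → TrivOn b v)
    {A : Type*} [AddCommGroup A] [IsAddTorsionFree A] (ρab : D.DeltaHat →* Module.End ℤ A)
    (hinner : (T.Jhat i).subgroupOf D.DeltaHat ≤ ρab.ker)
    (hunip : ∀ b : D.DeltaHat, (∀ v, act b v = v ∧ TrivOn b v) → IsNilpotent (ρab b - 1))
    (hfaith : ∀ b : D.DeltaHat, ρab b = 1 → b ∈ (T.Jhat i).subgroupOf D.DeltaHat)
    (a : D.DeltaHat)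
    (ha : ∀ x ∈ (T.Jhat i).subgroupOf D.DeltaHat, x ∈ D.ρHat.ker → a * x = x * a) :
    a ∈ (T.Jhat i).subgroupOf D.DeltaHat := by
  haveI := hN i
  exact D.mem_level_of_comm_ker_of_inputs hΔc hρc ((T.Jhat i).subgroupOf D.DeltaHat) (hO i) act Ks Pv
    hequiv hA3 Jv hJvP hJvJ hJvc hl L ql hqlc hqls hLl hLna hqlK hSigv TrivOn h311 ρab hinner hunip
    hfaith a ha

end Generic

/-! ### At the genuine 𝔛-datum `ofSpecialFibre`, tower `towerOfSpecialFibreTower` -/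

section Genuine

variable {p : ℕ} [Fact p.Prime] (X : TemperedCurve p) (d : X.GroupLevelData)
  (S : SpecialFibreData (X.toTemperedArithmeticGroup d)) (h36 : S.Gc.Prop36Hypotheses)
  (Sigma SigmaHat : Set ℕ) (hsub : Sigma ⊆ SigmaHat) (hne : Sigma.Nonempty)
  (hprime : ∀ q ∈ SigmaHat, q.Prime) (hp : p ∉ Sigma)
  (TpH : Subgroup S.chart.G)
  (HatH : Subgroup (TemperedGraphGroupData.exists_completion_of_prop36 S.Gc h36 S.chart).choose)
  (hle : TpH.map (TemperedGraphGroupData.exists_completion_of_prop36 S.Gc h36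
    S.chart).choose_spec.choose.toMonoidHom ≤ HatH)
  (cuspMeetsH : {x : X.Pt // X.IsCusp x} → Prop)
  (T : SpecialFibreTower X.DeltaTemp)

/-- **[IUTchI] Cor. 2.3 (iii), first sentence, at the level `Ĵ_i ∩ Δ̂_X` of the GENUINE 𝔛-datum,
condition (a), KERNEL FORM, EVERY STRUCTURAL SIDE CONDITION DISCHARGED**: the level is normal and open
(abc-iut-L5-t11's `towerOfSpecialFibreTower_levelsNormal` / `_levelsOpen`), `Δ̂_X` is closed, `ρ̂` is
continuous and `Π̂_𝔾` is Hausdorff (abc-iut-w4-d058's `ofSpecialFibre_isClosed_deltaHat` /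
`_continuous_ρHat` / `_t2Space_graphHat`), the prime `l` lies outside the datum's `Σ`; what remains is
EXACTLY the printed per-level input list of `mem_level_of_comm_ker_of_inputs` (p. 48 l. 44 – p. 49
l. 32) at this level. [cite: Mochizuki2012, Cor 2.3(iii) pp.48-49] -/
theorem kerLevel_ofSpecialFibre_towerLevel_of_inputs (i : ℕ)
    {V : Type*}
    (act : (ofSpecialFibre X d S h36 Sigma SigmaHat hsub hne hprime hp TpH HatH hle cuspMeetsH).DeltaHat →
      V → V)
    (Ks : Subgroup (ofSpecialFibre X d S h36 Sigma SigmaHat hsub hne hprime hp TpH HatH hle cuspMeetsH).DeltaHat)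
    (Pv : V → Subgroup (ofSpecialFibre X d S h36 Sigma SigmaHat hsub hne hprime hp TpH HatH hle
      cuspMeetsH).DeltaHat)
    (hequiv : ∀ (b : (ofSpecialFibre X d S h36 Sigma SigmaHat hsub hne hprime hp TpH HatH hle
        cuspMeetsH).DeltaHat) (v : V),
      ∃ j ∈ ((OfSpecialFibre.towerOfSpecialFibreTower X d T Sigma SigmaHat hsub hne hprime S h36 hp TpH
          HatH hle cuspMeetsH).Jhat i).subgroupOf
            (ofSpecialFibre X d S h36 Sigma SigmaHat hsub hne hprime hp TpH HatH hle cuspMeetsH).DeltaHat,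
        (Pv v).map (MulAut.conj b).toMonoidHom = (Pv (act b v)).map (MulAut.conj j).toMonoidHom)
    (hA3 : ∀ (v w : V),
      ∀ g ∈ ((OfSpecialFibre.towerOfSpecialFibreTower X d T Sigma SigmaHat hsub hne hprime S h36 hp TpH
          HatH hle cuspMeetsH).Jhat i).subgroupOf
            (ofSpecialFibre X d S h36 Sigma SigmaHat hsub hne hprime hp TpH HatH hle cuspMeetsH).DeltaHat,
      ∀ h ∈ ((OfSpecialFibre.towerOfSpecialFibreTower X d T Sigma SigmaHat hsub hne hprime S h36 hp TpH
          HatH hle cuspMeetsH).Jhat i).subgroupOf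
            (ofSpecialFibre X d S h36 Sigma SigmaHat hsub hne hprime hp TpH HatH hle cuspMeetsH).DeltaHat,
      (∃ x ∈ (Pv v).map (MulAut.conj g).toMonoidHom ⊓ (Pv w).map (MulAut.conj h).toMonoidHom,
        ∃ y ∈ (Pv v).map (MulAut.conj g).toMonoidHom ⊓ (Pv w).map (MulAut.conj h).toMonoidHom,
          x * y * x⁻¹ * y⁻¹ ∉ Ks) → v = w)
    (Jv : V → Subgroup (ofSpecialFibre X d S h36 Sigma SigmaHat hsub hne hprime hp TpH HatH hle
      cuspMeetsH).DeltaHat)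
    (hJvP : ∀ v, Jv v ≤ Pv v)
    (hJvJ : ∀ v, Jv v ≤ ((OfSpecialFibre.towerOfSpecialFibreTower X d T Sigma SigmaHat hsub hne hprime S h36
        hp TpH HatH hle cuspMeetsH).Jhat i).subgroupOf
          (ofSpecialFibre X d S h36 Sigma SigmaHat hsub hne hprime hp TpH HatH hle cuspMeetsH).DeltaHat)
    (hJvc : ∀ v, IsClosed (Jv v : Set (ofSpecialFibre X d S h36 Sigma SigmaHat hsub hne hprime hp TpH HatH hle
      cuspMeetsH).DeltaHat))
    {l : ℕ} (hl : l ∉ Sigma)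
    (L : V → Type*) [∀ v, Group (L v)] [∀ v, TopologicalSpace (L v)]
    [∀ v, IsTopologicalGroup (L v)] [∀ v, CompactSpace (L v)]
    [∀ v, TotallyDisconnectedSpace (L v)] [∀ v, T2Space (L v)]
    (ql : ∀ v, Jv v →* L v) (hqlc : ∀ v, Continuous (ql v))
    (hqls : ∀ v, Function.Surjective (ql v)) (hLl : ∀ v, IsProSigma {l} (L v))
    (hLna : ∀ v, ∃ x y : L v, x * y ≠ y * x)
    (hqlK : ∀ v (x : Jv v),
      (x : (ofSpecialFibre X d S h36 Sigma SigmaHat hsub hne hprime hp TpH HatH hle cuspMeetsH).DeltaHat) ∈ Ks →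
        ql v x = 1)
    (hSigv : ∀ (v : V) (M : Subgroup (Jv v)), M.Normal → IsOpen (M : Set (Jv v)) →
      ((ofSpecialFibre X d S h36 Sigma SigmaHat hsub hne hprime hp TpH HatH hle cuspMeetsH).ρHat.ker).subgroupOf
          (Jv v) ≤ M →
        ∀ p : ℕ, p.Prime → p ∣ M.index → p ∈ Sigma)
    (TrivOn : (ofSpecialFibre X d S h36 Sigma SigmaHat hsub hne hprime hp TpH HatH hle cuspMeetsH).DeltaHat →
      V → Prop)
    (h311 : ∀ (b : (ofSpecialFibre X d S h36 Sigma SigmaHat hsub hne hprime hp TpH HatH hle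
        cuspMeetsH).DeltaHat) (v : V), act b v = v →
      (∀ y : L v, ∃ x : Jv v, ql v x = y ∧
        b * (x : (ofSpecialFibre X d S h36 Sigma SigmaHat hsub hne hprime hp TpH HatH hle
          cuspMeetsH).DeltaHat) * b⁻¹ = x) → TrivOn b v)
    {A : Type*} [AddCommGroup A] [IsAddTorsionFree A]
    (ρab : (ofSpecialFibre X d S h36 Sigma SigmaHat hsub hne hprime hp TpH HatH hle cuspMeetsH).DeltaHat →*
      Module.End ℤ A)
    (hinner : ((OfSpecialFibre.towerOfSpecialFibreTower X d T Sigma SigmaHat hsub hne hprime S h36 hp TpH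
        HatH hle cuspMeetsH).Jhat i).subgroupOf
          (ofSpecialFibre X d S h36 Sigma SigmaHat hsub hne hprime hp TpH HatH hle cuspMeetsH).DeltaHat ≤
      ρab.ker)
    (hunip : ∀ b : (ofSpecialFibre X d S h36 Sigma SigmaHat hsub hne hprime hp TpH HatH hle
        cuspMeetsH).DeltaHat,
      (∀ v, act b v = v ∧ TrivOn b v) → IsNilpotent (ρab b - 1))
    (hfaith : ∀ b : (ofSpecialFibre X d S h36 Sigma SigmaHat hsub hne hprime hp TpH HatH hle
        cuspMeetsH).DeltaHat,
      ρab b = 1 →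
        b ∈ ((OfSpecialFibre.towerOfSpecialFibreTower X d T Sigma SigmaHat hsub hne hprime S h36 hp TpH
            HatH hle cuspMeetsH).Jhat i).subgroupOf
          (ofSpecialFibre X d S h36 Sigma SigmaHat hsub hne hprime hp TpH HatH hle cuspMeetsH).DeltaHat)
    (a : (ofSpecialFibre X d S h36 Sigma SigmaHat hsub hne hprime hp TpH HatH hle cuspMeetsH).DeltaHat)
    (ha : ∀ x ∈ ((OfSpecialFibre.towerOfSpecialFibreTower X d T Sigma SigmaHat hsub hne hprime S h36 hp TpH
        HatH hle cuspMeetsH).Jhat i).subgroupOf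
          (ofSpecialFibre X d S h36 Sigma SigmaHat hsub hne hprime hp TpH HatH hle cuspMeetsH).DeltaHat,
      x ∈ (ofSpecialFibre X d S h36 Sigma SigmaHat hsub hne hprime hp TpH HatH hle cuspMeetsH).ρHat.ker →
        a * x = x * a) :
    a ∈ ((OfSpecialFibre.towerOfSpecialFibreTower X d T Sigma SigmaHat hsub hne hprime S h36 hp TpH HatH hle
        cuspMeetsH).Jhat i).subgroupOf
      (ofSpecialFibre X d S h36 Sigma SigmaHat hsub hne hprime hp TpH HatH hle cuspMeetsH).DeltaHat := by
  haveI := ofSpecialFibre_t2Space_graphHat X d S h36 Sigma SigmaHat hsub hne hprime hp TpH HatH hle cuspMeetsH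
  exact kerLevel_towerLevel_of_inputs
    (ofSpecialFibre X d S h36 Sigma SigmaHat hsub hne hprime hp TpH HatH hle cuspMeetsH)
    (OfSpecialFibre.towerOfSpecialFibreTower X d T Sigma SigmaHat hsub hne hprime S h36 hp TpH HatH hle
      cuspMeetsH)
    (OfSpecialFibre.towerOfSpecialFibreTower_levelsNormal X d T Sigma SigmaHat hsub hne hprime S h36 hp TpH
      HatH hle cuspMeetsH)
    (OfSpecialFibre.towerOfSpecialFibreTower_levelsOpen X d T Sigma SigmaHat hsub hne hprime S h36 hp TpH
      HatH hle cuspMeetsH)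
    (ofSpecialFibre_isClosed_deltaHat X d S h36 Sigma SigmaHat hsub hne hprime hp TpH HatH hle cuspMeetsH)
    (ofSpecialFibre_continuous_ρHat X d S h36 Sigma SigmaHat hsub hne hprime hp TpH HatH hle cuspMeetsH)
    i act Ks Pv hequiv hA3 Jv hJvP hJvJ hJvc hl L ql hqlc hqls hLl hLna hqlK hSigv TrivOn h311 ρab hinner
    hunip hfaith a ha

end Genuine

end StableCurveTemperedData

end Literature.IUT.HodgeTheaters

end
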